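import Summits.ResolutionOfSingularities.ResolutionOfSingularities.Theorems.PurelyInseparableDim4IsolatedScope
import Summits.ResolutionOfSingularities.ResolutionOfSingularities.Theorems.PurelyInseparableDim4IsolatedCleaning
import HarnessLib

/-!
# [OURS · res-dim4-pi] PERMISSIBLE = INSIDE THE LOCUS: for a clean `F` and `q = p`, Hauser–Perlega's
  condition (1) `p ≤ ord_{(x_S)} F` is EQUIVALENT to `J_p⁺(F) ≤ (x_S)` (the coordinate subspace `V(z, x_S)`
  lies in the `p`-fold locus), and every coordinate component of the locus is a permissible centre

Cell `res-dim4-pi` (D-0157 DOOR 2, wave 2), seat `res-dim4-p-6`; a dictionary lemma between the TARGET frame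
(`PIDim4.IsPermissibleCentre`, desk WORD #3 condition (1), typed as `q ≤ CentreBlowup.ordAlong S F`) and the
SCOPE add-on (`PIDim4.singLocusIdeal q F = J_q⁺(F) = ⟨D^{(α)}F : 0 < |α| < q⟩`, frame v4).  p-12's
`IsolatedScope.singLocusIdeal_le_span_X` is the direction (1) ⇒ `J_q⁺(F) ≤ (x_S)`; THIS FILE proves the
converse for CLEAN `F` at the exponent of record `q = p` (prime, characteristic `p`), by Lucas' theorem:

* `natCast_choose_mod_ne_zero` — `C(n, n mod p) ≡ 1 (mod p)` (Lucas; used at a coordinate with `p ∤ dᵢ`);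
* `exists_hasse_witness` — a monomial `x^d` of `S`-degree `< p` which is not a `p`-th power yields an
  `α` (`0 < |α| < p`) with `coeff_{d−α} (D^{(α)} x^d) ≠ 0` and `x^{d−α}` free of the variables of `S`
  (take `α = d|_S` if `d|_S ≠ 0`, else `α = (dᵢ mod p)·eᵢ` at a coordinate with `p ∤ dᵢ`);
* **`le_ordAlong_of_singLocusIdeal_le_span_X`** — clean `F`, `J_p⁺(F) ≤ (x_S)` ⇒ `p ≤ ord_{(x_S)} F`;
* **`isPermissibleCentre_iff_singLocusIdeal_le`** — for clean `F`: `IsPermissibleCentre p S F ↔ S ≠ ∅ ∧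
  J_p⁺(F) ≤ (x_S)` (condition (1) IS «the centre lies in the `p`-fold locus», read on ideals);
* **`isPermissibleCentre_of_mem_minimalPrimes`** — for a clean non-zero `F` IN COORDINATE SCOPE
  (`InCoordinateScope`), every minimal prime of `J_p⁺(F)` through the origin is `(x_S)` for a
  Hironaka-PERMISSIBLE `S`: the components of the `p`-fold locus through the point are available centres of
  the frame (the rule «blow up a component», frame v4 F4-C, is a `CentreRule` on in-scope states).

Without cleanness the converse fails (`F = x₁^p`: `J_p⁺ = 0`); the cell's states are cleaned at every step
(`CentreBlowup.deletePthPowers_step`).  [OURS · counted 0 · elementary · AI kernel work, weaker than expert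
review.]  NOTHING here is a statement about resolution of singularities; resolution in dimension `≥ 4` /
characteristic `p > 0` is NOT proved by anything in this file.
bears_on: LADDER-RESOLUTION:D157-DOOR2 (res-dim4-pi · frame v4 dictionary).  Host item (DR-157-C): `stmt-ResolutionOfSingularities-16155`.
-/

noncomputable section

set_option linter.dupNamespace false -- mandated namespace of this single-conjunct summit

open MvPolynomial Finset

open scoped BigOperators

namespace Summit.ResolutionOfSingularities.ResolutionOfSingularities.Theorems.PIDim4

namespace PermissibleLocus

open Literature.AlgebraicGeometry.Resolution
open Literature.AlgebraicGeometry.Resolution.CentreBlowup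
open Literature.AlgebraicGeometry.Resolution.Hauser2010

variable {K : Type} [Field K]

/-! ## §1 Lucas: the non-vanishing binomial at the lowest non-zero digit -/

/-- **Lucas, non-vanishing half**: `C(n, n mod p) = 1 ≠ 0` in characteristic `p`
(`C(n, r) ≡ C(n mod p, r)·C(n/p, 0) = C(r, r) = 1` for `r = n mod p`; used when `p ∤ n`, so `0 < r < p`). [folklore] -/
theorem natCast_choose_mod_ne_zero (p : ℕ) [hp : Fact p.Prime] [CharP K p] (n : ℕ) :
    (Nat.choose n (n % p) : K) ≠ 0 := by
  have hmod := Choose.choose_modEq_choose_mod_mul_choose_div_nat (n := n) (k := n % p) (p := p)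
  rw [Nat.mod_mod_of_dvd n (dvd_refl p), Nat.choose_self, Nat.div_eq_of_lt (Nat.mod_lt n hp.out.pos),
    Nat.choose_zero_right, mul_one] at hmod
  rw [(CharP.natCast_eq_natCast K p).mpr hmod, Nat.cast_one]
  exact one_ne_zero

/-! ## §2 The Hasse witness of a low monomial -/

/-- The restriction `d|_S` of an exponent to `S` has degree `degIn S d`. [folklore] -/
theorem degree_filter_eq_degIn (S : Finset (Fin 4)) (d : Fin 4 →₀ ℕ) :
    (d.filter (· ∈ S)).degree = degIn S d := by
  classical
  rw [Finsupp.degree_eq_sum, degIn, ← Finset.sum_filter_add_sum_filter_not Finset.univ (· ∈ S)]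
  have h1 : ∑ i ∈ Finset.univ.filter (· ∈ S), (d.filter (· ∈ S)) i = ∑ i ∈ S, d i := by
    rw [Finset.filter_mem_eq_inter, Finset.univ_inter]
    exact Finset.sum_congr rfl fun i hi => Finsupp.filter_apply_pos _ _ hi
  have h2 : ∑ i ∈ Finset.univ.filter (fun i => ¬ i ∈ S), (d.filter (· ∈ S)) i = 0 :=
    Finset.sum_eq_zero fun i hi => Finsupp.filter_apply_neg _ _ (Finset.mem_filter.mp hi).2
  rw [h1, h2, add_zero]

/-- **The Hasse witness.**  Let `x^d` be a monomial of `S`-degree `< p` which is not a `p`-th power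
(characteristic `p`).  Then some `α` with `0 < |α| < p` and some `e` with `e + α = d` have
`∏ᵢ C(dᵢ, αᵢ) ≠ 0` in `K` and `eᵢ = 0` for every `i ∈ S` — so `x^e` is the non-zero coefficient-carrying
monomial of `D^{(α)} x^d` and lies OUTSIDE the ideal `(x_S)`.  (`α = d|_S` if `degIn S d > 0`, else
`α = (dᵢ mod p)·eᵢ` at a coordinate with `p ∤ dᵢ`, by Lucas.) [folklore] -/
theorem exists_hasse_witness (p : ℕ) [hp : Fact p.Prime] [CharP K p] {S : Finset (Fin 4)}
    {d : Fin 4 →₀ ℕ} (hd : ¬ IsPthPowerExponent p d) (hdS : degIn S d < p) :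
    ∃ α e : Fin 4 →₀ ℕ, 0 < α.degree ∧ α.degree < p ∧ e + α = d ∧
      (∏ i, (Nat.choose (d i) (α i) : K)) ≠ 0 ∧ ∀ i ∈ S, e i = 0 := by
  classical
  by_cases hk : 0 < degIn S d
  · -- `α = d|_S`, `e = d|_{Sᶜ}`
    refine ⟨d.filter (· ∈ S), d.filter (fun i => ¬ i ∈ S), ?_, ?_, ?_, ?_, ?_⟩
    · rwa [degree_filter_eq_degIn]
    · rwa [degree_filter_eq_degIn]
    · rw [add_comm]; exact Finsupp.filter_add_filter_not d (· ∈ S)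
    · refine Finset.prod_ne_zero_iff.mpr fun i _ => ?_
      by_cases hi : i ∈ S
      · rw [Finsupp.filter_apply_pos _ _ hi, Nat.choose_self, Nat.cast_one]; exact one_ne_zero
      · rw [Finsupp.filter_apply_neg _ _ hi, Nat.choose_zero_right, Nat.cast_one]; exact one_ne_zero
    · intro i hi
      exact Finsupp.filter_apply_neg _ _ (not_not_intro hi)
  · -- `degIn S d = 0`: a coordinate `i ∉ S` with `p ∤ dᵢ`; `α = (dᵢ mod p)·eᵢ`
    have hS0 : ∀ i ∈ S, d i = 0 := fun i hi => by
      have := degIn_eq_zero_iff.mp (Nat.eq_zero_of_not_pos hk) i hi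
      exact this
    obtain ⟨i, hi⟩ : ∃ i, ¬ p ∣ d i := by
      by_contra hcon
      push Not at hcon
      exact hd ((isPthPowerExponent_iff p d).mpr hcon)
    have hiS : i ∉ S := fun h => hi (by rw [hS0 i h]; exact dvd_zero p)
    have hr0 : 0 < d i % p := Nat.pos_of_ne_zero fun h => hi (Nat.dvd_of_mod_eq_zero h)
    have hrp : d i % p < p := Nat.mod_lt _ hp.out.pos
    have hrd : d i % p ≤ d i := Nat.mod_le _ _
    refine ⟨Finsupp.single i (d i % p), d - Finsupp.single i (d i % p), ?_, ?_, ?_, ?_, ?_⟩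
    · rwa [Finsupp.degree_single]
    · rwa [Finsupp.degree_single]
    · ext k
      rw [Finsupp.add_apply, Finsupp.tsub_apply, Finsupp.single_apply]
      split_ifs with hik
      · subst hik; omega
      · omega
    · refine Finset.prod_ne_zero_iff.mpr fun k _ => ?_
      rw [Finsupp.single_apply]
      split_ifs with hik
      · subst hik; exact natCast_choose_mod_ne_zero p (d i)
      · rw [Nat.choose_zero_right, Nat.cast_one]; exact one_ne_zero
    · intro k hk'
      have hik : i ≠ k := fun h => hiS (h ▸ hk')
      rw [Finsupp.tsub_apply, Finsupp.single_apply, if_neg hik, hS0 k hk', Nat.zero_sub]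

/-! ## §3 Permissible = inside the locus -/

/-- **The converse of `IsolatedScope.singLocusIdeal_le_span_X` for clean `F`, `q = p`**: if every Hasse
derivative `D^{(α)}F` (`0 < |α| < p`) lies in `(x_S)`, then every monomial of `F` has `S`-degree `≥ p`.
[folklore] -/
theorem le_ordAlong_of_singLocusIdeal_le_span_X (p : ℕ) [Fact p.Prime] [CharP K p] {S : Finset (Fin 4)}
    {F : MvPolynomial (Fin 4) K} (hclean : deletePthPowers p F = F)
    (hJ : singLocusIdeal p F ≤ Ideal.span ((fun i => (X i : MvPolynomial (Fin 4) K)) '' (S : Set (Fin 4)))) :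
    (p : ℕ∞) ≤ ordAlong S F := by
  classical
  refine le_ordAlong_of_forall fun d hd => ?_
  by_contra hlt
  push Not at hlt
  obtain ⟨α, e, hα0, hαp, heα, hprod, heS⟩ :=
    exists_hasse_witness (K := K) p (PointBlowup.not_isPthPowerExponent_of_clean p hclean hd) hlt
  -- `x^e` carries the coefficient `∏ C(dᵢ, αᵢ) · coeff d F ≠ 0` of `D^{(α)}F`
  have hcoeff : coeff e (hasseDeriv α F) ≠ 0 := by
    rw [IsolatedBand.coeff_hasseDeriv, heα]
    have hprod' : (∏ i, (Nat.choose (e i + α i) (α i) : K)) = ∏ i, (Nat.choose (d i) (α i) : K) :=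
      Finset.prod_congr rfl fun i _ => by rw [← Finsupp.add_apply, heα]
    rw [hprod']
    exact mul_ne_zero hprod (MvPolynomial.mem_support_iff.mp hd)
  -- but `D^{(α)}F ∈ J_p⁺(F) ≤ (x_S)` and `x^e` is free of the variables of `S`
  have hmem : hasseDeriv α F ∈ singLocusIdeal p F := Ideal.subset_span ⟨α, hα0, hαp, rfl⟩
  obtain ⟨i, hiS, hi⟩ := MvPolynomial.mem_ideal_span_X_image.mp (hJ hmem) e
    (MvPolynomial.mem_support_iff.mpr hcoeff)
  exact hi (heS i (Finset.mem_coe.mp hiS))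

/-- **CONDITION (1) = «THE CENTRE LIES IN THE `p`-FOLD LOCUS»** (clean `F`, `q = p`):
`IsPermissibleCentre p S F ↔ S.Nonempty ∧ J_p⁺(F) ≤ (x_S)`. [cite: HauserPerlega2019PRIMS, §2 (condition (1) f ∈ P^{c!})] -/
theorem isPermissibleCentre_iff_singLocusIdeal_le (p : ℕ) [Fact p.Prime] [CharP K p] {S : Finset (Fin 4)}
    {F : MvPolynomial (Fin 4) K} (hclean : deletePthPowers p F = F) :
    IsPermissibleCentre p S F ↔ S.Nonempty ∧
      singLocusIdeal p F ≤ Ideal.span ((fun i => (X i : MvPolynomial (Fin 4) K)) '' (S : Set (Fin 4))) :=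
  ⟨fun h => ⟨h.1, IsolatedScope.singLocusIdeal_le_span_X h.2⟩,
    fun h => ⟨h.1, le_ordAlong_of_singLocusIdeal_le_span_X p hclean h.2⟩⟩

/-! ## §4 In coordinate scope the components of the locus are available centres -/

/-- A clean non-zero `F` has a non-zero Hasse derivative of order `< p`, so `J_p⁺(F) ≠ 0`. [folklore] -/
theorem singLocusIdeal_ne_bot (p : ℕ) [Fact p.Prime] [CharP K p] {F : MvPolynomial (Fin 4) K}
    (hclean : deletePthPowers p F = F) (hF : F ≠ 0) : singLocusIdeal p F ≠ ⊥ := by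
  classical
  intro hbot
  obtain ⟨d, hd⟩ := MvPolynomial.support_nonempty.mpr hF
  -- with `S = ∅` every monomial has `S`-degree `0 < p`
  obtain ⟨α, e, hα0, hαp, heα, hprod, -⟩ := exists_hasse_witness (K := K) (S := ∅) p
    (PointBlowup.not_isPthPowerExponent_of_clean p hclean hd) (by rw [degIn_empty]; exact (Fact.out : p.Prime).pos)
  have hcoeff : coeff e (hasseDeriv α F) ≠ 0 := by
    rw [IsolatedBand.coeff_hasseDeriv, heα]
    have hprod' : (∏ i, (Nat.choose (e i + α i) (α i) : K)) = ∏ i, (Nat.choose (d i) (α i) : K) :=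
      Finset.prod_congr rfl fun i _ => by rw [← Finsupp.add_apply, heα]
    rw [hprod']
    exact mul_ne_zero hprod (MvPolynomial.mem_support_iff.mp hd)
  have hmem : hasseDeriv α F ∈ singLocusIdeal p F := Ideal.subset_span ⟨α, hα0, hαp, rfl⟩
  rw [hbot, Ideal.mem_bot] at hmem
  exact hcoeff (by rw [hmem, coeff_zero])

/-- **Every coordinate component of the `p`-fold locus through the origin is a Hironaka-permissible centre**:
for a clean non-zero `F` in coordinate scope, each minimal prime `P ≤ 𝔪₀` of `J_p⁺(F)` is `(x_S)` with
`IsPermissibleCentre p S F` — the rule «blow up a component of the locus» (frame v4, F4-C) is a permissible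
`CentreRule` on in-scope states. [folklore] -/
theorem isPermissibleCentre_of_mem_minimalPrimes (p : ℕ) [Fact p.Prime] [CharP K p]
    {F : MvPolynomial (Fin 4) K} (hclean : deletePthPowers p F = F) (hF : F ≠ 0)
    (hscope : InCoordinateScope p F) {P : Ideal (MvPolynomial (Fin 4) K)}
    (hP : P ∈ (singLocusIdeal p F).minimalPrimes) (hP0 : P ≤ originIdeal K) :
    ∃ S : Finset (Fin 4), P = Ideal.span ((fun i => (X i : MvPolynomial (Fin 4) K)) '' (S : Set (Fin 4))) ∧
      IsPermissibleCentre p S F := by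
  obtain ⟨S, hS⟩ := hscope P hP hP0
  have hJP : singLocusIdeal p F ≤ P := hP.1.2
  refine ⟨S, hS, (isPermissibleCentre_iff_singLocusIdeal_le p hclean).mpr ⟨?_, hS ▸ hJP⟩⟩
  rw [Finset.nonempty_iff_ne_empty]
  rintro rfl
  apply singLocusIdeal_ne_bot p hclean hF
  rw [eq_bot_iff]
  refine hJP.trans (le_of_eq ?_)
  rw [hS, Finset.coe_empty, Set.image_empty, Ideal.span_empty]

end PermissibleLocus

end Summit.ResolutionOfSingularities.ResolutionOfSingularities.Theorems.PIDim4

end
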